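import Literature.NumberTheory.Automorphic.RankinSelbergUnfoldingRealPoint
import Literature.NumberTheory.Automorphic.AutomorphicMeasureSiegelDomination
import Literature.NumberTheory.Automorphic.GLnCuspidalSiegelDecay
import Literature.NumberTheory.Automorphic.AutomorphicMeasureGLDomain
import HarnessLib

/-!
# The unfolded Rankin–Selberg integral is finite at every real point `σ > 1`, for every Schwartz `Φ ≥ 0`

Topic `NumberTheory/Automorphic`; namespace `Literature.NumberTheory.Automorphic`. Proof file (theorems
only). `RankinSelbergTowerFiniteness` proves `Ψ(σ; W_φ, W̄_φ, Φ) < ∞`, `σ > 1`, for the ONE test function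
`Φ = e^{-‖·‖} ⊗ 𝟙_{𝒪̂ⁿ}` (going UP the Whittaker tower by Bessel's inequality). This file proves it for
EVERY real Schwartz–Bruhat `Φ ≥ 0` (in particular for the Gaussian standard test function of the residue
datum, `StandardTestFunGaussian`), going the other way: by the exact unfolding
`C₃ Ψ(σ) = ∫_G |φ|² w_{Φ,σ} β_G dν` (`WhittakerTowerParseval`) and the quotient unfolding
`∫_X E_X |φ̃|² dμ' = C₁ ∫_G w_{Φ,σ} β_G |φ|² dν` (`RankinSelbergQuotientUnfolding`), the finiteness of `Ψ(σ)`
is that of `∫_X E(x, Φ, σ) |φ̃(x)|² dμ'(x)`, which follows from the Siegel domination of the automorphic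
measure (`exists_lintegral_le_mul_setLIntegral_siegel`), the rapid decay of the smoothed cusp form
(`isRapidlyDecreasingGL_invQuot_smoothedForm`) and the finiteness of the Eisenstein majorant on Siegel
sets (`setLIntegral_siegel_normSq_mul_majorant_lt_top_of_mem_piSchwartzBruhat`) — the same inputs which make
the Rankin–Selberg integral a Bochner integral (Cogdell (2004), §2.3, p. 211; Jacquet–Shalika (1981), §4,
(4.6): "the integrals converge absolutely for `Re s > 1`").

* `setLIntegral_eisensteinWeight_scalar_mul_eq_tsum_mul` — the idele-class integral of the Eisenstein
  weight in majorant form: `∫_𝓕 w_{Φ,σ}((a 1_n) y) dν = (∑_ξ ∫_{𝔸ˣ} Φ(a ξ y) |a|^{nσ} dν) · |det y|^σ`;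
* `ideleNorm_det_le_of_mem_mul_siegelSet` — `|det g|` is bounded on a Siegel set `Z Ω A_{T₀}(t) K`;
* `rankinSelbergTorusIntegral_whittakerCoeff_ne_top_of_mem_piSchwartzBruhat` (**main**).

## References

* H. Jacquet, J. A. Shalika, *On Euler products and the classification of automorphic
  representations I*, Amer. J. Math. 103 (1981), §4, (4.6) [JacquetShalikaAJM1981].
* J. W. Cogdell, *Analytic theory of L-functions for GL_n*, in *An Introduction to the Langlands
  Program* (2004), §2.3, p. 211 [CogdellAnalyticTheory2004].
-/

noncomputable section

open MeasureTheory Measure NumberField IsDedekindDomain Matrix Set Filter Topology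
open scoped ENNReal NNReal ComplexConjugate Pointwise MatrixGroups

namespace Literature.NumberTheory.Automorphic

open Literature.NumberTheory.GaloisRepresentations (ideleGroup)
open Literature.MeasureTheory.Group (coveringSum IsCoveringWeight)

-- the automorphic quotient carries the tree's Borel σ-algebra, not Mathlib's quotient σ-algebra
attribute [-instance] Quotient.instMeasurableSpace QuotientGroup.measurableSpace

section Majorant

variable {n : ℕ} {K : Type} [Field K] [NumberField K]
variable [MeasurableSpace (AdeleRing (𝓞 K) K)] [BorelSpace (AdeleRing (𝓞 K) K)]
variable (ν : Measure (ideleGroup K)) [ν.IsHaarMeasure]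

/-- **The idele-class integral of the Eisenstein weight in majorant form.** For a continuous real
`Φ ≥ 0`, a real `σ`, an idele class domain `𝓕` and `y ∈ GL_n(𝔸_K)`:
`∫_𝓕 w_{Φ,σ}((a 1_n) y) dν(a) = (∑_{ξ ∈ ℙ(Kⁿ)} ∫_{𝔸ˣ} Φ(a ξ y) |a|^{nσ} dν(a)) · |det y|^σ` in `[0, ∞]`
(`eisensteinWeight_scalar_mul` and the unfolding `∫_𝓕 ∑_{v ≠ 0} = ∑_ξ ∫_{𝔸ˣ}`,
`setLIntegral_tsum_enorm_mul_eq_tsum_lintegral`). [folklore] -/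
theorem setLIntegral_eisensteinWeight_scalar_mul_eq_tsum_mul {𝓕 : Set (ideleGroup K)}
    (h𝓕 : IsIdeleClassDomain K 𝓕) {Φ : (Fin n → AdeleRing (𝓞 K) K) → ℝ} (hΦc : Continuous Φ)
    (hΦ0 : ∀ x, 0 ≤ Φ x) (σ : ℝ) (y : GL (Fin n) (AdeleRing (𝓞 K) K)) :
    ∫⁻ a in 𝓕, eisensteinWeight n K Φ σ (Matrix.GeneralLinearGroup.scalar (Fin n) a * y) ∂ν =
      (∑' p : Projectivization K (Fin n → K),
          ∫⁻ a, (‖((Φ ((a : AdeleRing (𝓞 K) K) •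
              (ratVec K p.rep ᵥ* (y : Matrix (Fin n) (Fin n) (AdeleRing (𝓞 K) K)))) : ℝ) : ℂ)‖ₑ : ℝ≥0∞) *
            ENNReal.ofReal ((IdeleClassGroup.ideleNorm K a : ℝ) ^ ((n : ℝ) * σ)) ∂ν) *
        ENNReal.ofReal ((IdeleClassGroup.ideleNorm K (Matrix.GeneralLinearGroup.det y) : ℝ) ^ σ) := by
  haveI := borelSpace_ideleGroup K
  set q : ℝ := (IdeleClassGroup.ideleNorm K (Matrix.GeneralLinearGroup.det y) : ℝ) with hq
  have hq0 : 0 ≤ q := NNReal.coe_nonneg _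
  set Ψ : (Fin n → AdeleRing (𝓞 K) K) → ℂ :=
    fun x => (Φ (x ᵥ* (y : Matrix (Fin n) (Fin n) (AdeleRing (𝓞 K) K))) : ℂ) with hΨ
  have hΨc : Continuous Ψ :=
    Complex.continuous_ofReal.comp (hΦc.comp (continuous_id.matrix_vecMul continuous_const))
  -- pointwise: `w((a 1_n) y) = (∑_{v ≠ 0} ‖Ψ(a v)‖ₑ) · |a|^{nσ} · q^σ`
  have hpow : ∀ a : ideleGroup K, ((IdeleClassGroup.ideleNorm K a : ℝ) ^ n * q) ^ σ =
      (IdeleClassGroup.ideleNorm K a : ℝ) ^ ((n : ℝ) * σ) * q ^ σ := fun a => by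
    rw [Real.mul_rpow (pow_nonneg (NNReal.coe_nonneg _) _) hq0, ← Real.rpow_natCast,
      ← Real.rpow_mul (NNReal.coe_nonneg _)]
  have hpt : ∀ a : ideleGroup K, eisensteinWeight n K Φ σ (Matrix.GeneralLinearGroup.scalar (Fin n) a * y) =
      (∑' v : (({0} : Set (Fin n → K))ᶜ : Set (Fin n → K)),
          (‖Ψ ((a : AdeleRing (𝓞 K) K) • ratVec K (v : Fin n → K))‖ₑ : ℝ≥0∞)) *
        ENNReal.ofReal ((IdeleClassGroup.ideleNorm K a : ℝ) ^ ((n : ℝ) * σ)) * ENNReal.ofReal (q ^ σ) := by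
    intro a
    rw [eisensteinWeight_scalar_mul hΦ0, hpow, ENNReal.ofReal_mul (Real.rpow_nonneg (NNReal.coe_nonneg _) _),
      ← mul_assoc]
    congr 2
    refine (tsum_congr fun v => ?_).trans rfl
    rw [hΨ]
    simp only []
    rw [Matrix.smul_vecMul, ← ofReal_norm, Complex.norm_real, Real.norm_of_nonneg (hΦ0 _)]
  simp_rw [hpt]
  rw [lintegral_mul_const' _ _ ENNReal.ofReal_ne_top,
    setLIntegral_tsum_enorm_mul_eq_tsum_lintegral ν h𝓕 hΨc ((n : ℝ) * σ)]
  congr 1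
  refine tsum_congr fun p => lintegral_congr fun a => ?_
  rw [hΨ]
  simp only []
  rw [Matrix.smul_vecMul]

end Majorant

section DetBound

variable {n : ℕ} {K : Type} [Field K] [NumberField K]

/-- **`|det g|` is bounded on a Siegel set** `Z · (Ω · A_{T₀}(t) · K)` with `Z`, `Ω` compact: `|det| = 1`
on the cone `A_{T₀}(t)` (`glAbsDet_eq_one_of_mem_siegelCone`) and on the compact subgroup `K`
(`ideleNorm_det_eq_one_of_isCompact`), and `|det|` is continuous on the compact sets `Z`, `Ω`. [folklore] -/
theorem exists_ideleNorm_det_le_of_mem_mul_siegelSet {Ω Z : Set (GL (Fin n) (AdeleRing (𝓞 K) K))}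
    (hΩc : IsCompact Ω) (hZc : IsCompact Z) (t : ℝ) :
    ∃ D : ℝ, 0 ≤ D ∧ ∀ g ∈ Z * (Ω * siegelCone n K t *
        (standardMaximalCompactGL n K : Set (GL (Fin n) (AdeleRing (𝓞 K) K)))),
      (IdeleClassGroup.ideleNorm K (Matrix.GeneralLinearGroup.det g) : ℝ) ≤ D := by
  set d : GL (Fin n) (AdeleRing (𝓞 K) K) → ℝ := fun g =>
    (IdeleClassGroup.ideleNorm K (Matrix.GeneralLinearGroup.det g) : ℝ) with hd
  have hdc : Continuous d :=
    NNReal.continuous_coe.comp ((continuous_ideleNorm_holds K).comp Matrix.GeneralLinearGroup.continuous_det)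
  have hdmul : ∀ g h, d (g * h) = d g * d h := fun g h => by
    simp only [hd, map_mul, NNReal.coe_mul]
  have hd0 : ∀ g, 0 ≤ d g := fun g => NNReal.coe_nonneg _
  obtain ⟨DZ, hDZ⟩ := (hZc.image hdc).isBounded.bddAbove
  obtain ⟨DΩ, hDΩ⟩ := (hΩc.image hdc).isBounded.bddAbove
  have hDZ' : ∀ z ∈ Z, d z ≤ max DZ 0 := fun z hz => (hDZ ⟨z, hz, rfl⟩).trans (le_max_left _ _)
  have hDΩ' : ∀ ω ∈ Ω, d ω ≤ max DΩ 0 := fun ω hω => (hDΩ ⟨ω, hω, rfl⟩).trans (le_max_left _ _)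
  refine ⟨max DZ 0 * max DΩ 0, mul_nonneg (le_max_right _ _) (le_max_right _ _), fun g hg => ?_⟩
  obtain ⟨z, hz, r, hr, rfl⟩ := Set.mem_mul.1 hg
  obtain ⟨u, hu, k, hk, rfl⟩ := Set.mem_mul.1 hr
  obtain ⟨ω, hω, c, hc, rfl⟩ := Set.mem_mul.1 hu
  have hcone : d c = 1 := by
    have h := glAbsDet_eq_one_of_mem_siegelCone (n := n) (K := K) hc
    have h' := congrArg (fun u : ℝ≥0ˣ => ((u : ℝ≥0) : ℝ)) h
    simpa [glAbsDet, hd] using h'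
  have hK : d k = 1 := by
    simp only [hd]
    rw [ideleNorm_det_eq_one_of_isCompact (isCompact_standardMaximalCompactGL n K) hk, NNReal.coe_one]
  change d (z * (ω * c * k)) ≤ _
  rw [hdmul, hdmul, hdmul, hcone, hK, mul_one, mul_one]
  exact mul_le_mul (hDZ' z hz) (hDΩ' ω hω) (hd0 ω) (le_max_right _ _)

end DetBound

section Finiteness

variable {n : ℕ} {K : Type} [Field K] [NumberField K]
variable [MeasurableSpace (AdeleRing (𝓞 K) K)] [BorelSpace (AdeleRing (𝓞 K) K)]

-- the house local instances: Borel structures of `GL_n(𝔸_K)` in both spellings and of `𝔸_Kˣ`; none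
-- overrides a Mathlib instance
attribute [local instance] adelicBorel borelSpace_adelic locallyCompactSpace_adelic secondCountableTopology_gl_adelic
  glAdeleBorel borelSpace_glAdele borelSpace_ideleGroup

/-- **The unfolded Rankin–Selberg integral of a smoothed cusp form is finite at every real point `σ > 1`,
for every real Schwartz–Bruhat `Φ ≥ 0`.** For a cuspidal automorphic representation `π` of `GL_n(𝔸_K)`
(`0 < n`), `f ∈ π`, a test function `η`, `φ = invQuot (S_η f)` and its Whittaker coefficient `W_φ`, a real
`Φ ≥ 0` with `Φ ∈ 𝒮(𝔸_Kⁿ)` and `g ↦ Φ(e_n g)` measurable, and Haar measures `νA`, `νK`: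
`Ψ(σ; W_φ, W̄_φ, Φ) = rankinSelbergTorusIntegral νA νK W_φ Φ σ < ∞` for `σ > 1` (Cogdell (2004), §2.3,
p. 211; Jacquet–Shalika (1981), §4, (4.6)). Proof: `C₁ C₃ Ψ(σ) = ∫_X E_X |φ̃|² dμ'` by the two unfoldings,
and the right side is finite by Siegel domination, rapid decay and the Eisenstein majorant.
[cite: JacquetShalikaAJM1981, §4] [cite: CogdellAnalyticTheory2004, §2.3] -/
theorem rankinSelbergTorusIntegral_whittakerCoeff_ne_top_of_mem_piSchwartzBruhat (hn : 0 < n)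
    {μ' : Measure (AdelicGroupData.gl n K).automorphicQuotient} [(AdelicGroupData.gl n K).IsAutomorphicMeasure μ']
    (νA : Measure (Fin n → ideleGroup K)) [IsHaarMeasure νA]
    (νK : Measure ↥(maximalCompactAdelic n K)) [IsHaarMeasure νK]
    (ν₀ : Measure ↥(adelicUnipotent n K)) [IsHaarMeasure ν₀]
    (P : CuspidalAutomorphicRepGL n K μ') (f : P.1.toSubmodule)
    {η : (AdelicGroupData.gl n K).Adelic → ℝ} (hη : IsTestFunctionGL n K η)
    {Φ : (Fin n → AdeleRing (𝓞 K) K) → ℝ} (hΦS : (fun x => (Φ x : ℂ)) ∈ piSchwartzBruhat K (Fin n))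
    (hΦ0 : ∀ x, 0 ≤ Φ x) (hΦm : Measurable fun g : GL (Fin n) (AdeleRing (𝓞 K) K) => Φ (lastRow n K g))
    {σ : ℝ} (hσ : 1 < σ) :
    rankinSelbergTorusIntegral n K νA νK
        (whittakerCoeff ν₀ (unipotentTateDomain n K) (adeleAddChar K)
          (invQuot (AdelicGroupData.gl n K) (smoothedForm η (f : (AdelicGroupData.gl n K).L2 μ'))))
        Φ σ ≠ ⊤ := by
  classical
  haveI : T2Space (GL (Fin n) (AdeleRing (𝓞 K) K)) := t2Space_gl n K
  haveI : LocallyCompactSpace (GL (Fin n) (AdeleRing (𝓞 K) K)) :=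
    AdelicGroupData.locallyCompactSpace_generalLinearGroup_adeleRing K (Fin n)
  haveI : SecondCountableTopology (GL (Fin n) (AdeleRing (𝓞 K) K)) :=
    secondCountableTopology_generalLinearGroup_adeleRing K (Fin n)
  -- Haar measures on `GL_n(𝔸_K)` and on `𝔸_Kˣ`, and the two unfolding constants
  set ν : Measure (GL (Fin n) (AdeleRing (𝓞 K) K)) := Measure.haar with hν
  haveI hνGL : IsHaarMeasure ν := by rw [hν]; infer_instance
  haveI hνgl : (show Measure (AdelicGroupData.gl n K).Adelic from ν).IsHaarMeasure := hνGL
  obtain ⟨νI, hνI⟩ := exists_isHaarMeasure_ideleGroup K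
  obtain ⟨C₁, hC₁0, hC₁t, h5⟩ := exists_lintegral_eisensteinLIntegral_mul_eq (n := n) (K := K) hn μ' ν νI
  obtain ⟨C₃, hC₃0, hC₃t, h3⟩ :=
    exists_mul_rankinSelbergTorusIntegral_eq_lintegral_eisensteinWeight (n := n) (K := K) hn ν νA νK ν₀
  obtain ⟨𝓕, h𝓕⟩ := exists_isIdeleClassDomain K
  obtain ⟨βG, hβG⟩ := exists_isCoveringWeight_ratPoints (n := n) (K := K) (⊤ : Subgroup (GL (Fin n) K))
  -- the datum
  set φt : (AdelicGroupData.gl n K).automorphicQuotient → ℂ :=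
    smoothedForm η (f : (AdelicGroupData.gl n K).L2 μ') with hφt
  set φ : GL (Fin n) (AdeleRing (𝓞 K) K) → ℂ := invQuot (AdelicGroupData.gl n K) φt with hφ
  have hφtc : Continuous φt := continuous_smoothedForm hη.continuous hη.hasCompactSupport _
  have hφc : Continuous φ := continuous_invQuot_smoothedForm hη.continuous hη.hasCompactSupport _
  have hφd : IsRapidlyDecreasingGL n K φ := isRapidlyDecreasingGL_invQuot_smoothedForm hη (P.2.1 f.2)
  have hφK : ∀ (γ₀ : GL (Fin n) K) (x : GL (Fin n) (AdeleRing (𝓞 K) K)),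
      φ (Matrix.GeneralLinearGroup.map (algebraMap K (AdeleRing (𝓞 K) K)) γ₀ * x) = φ x :=
    fun γ₀ x => isLeftInvariant_invQuot _ φt _ ⟨γ₀, rfl⟩ x
  have hcusp : ∀ k, 0 < k → k < n → CuspConditionGL n K φ k := fun k hk hkn =>
    cuspConditionGL_invQuot_smoothedForm hη.continuous hη.hasCompactSupport (P.2.1 f.2) hk hkn
  have hΦc : Continuous Φ := by
    have h : Continuous fun x => ((Φ x : ℂ)).re := Complex.continuous_re.comp (continuous_of_mem_piSchwartzBruhat hΦS)
    simpa only [Complex.ofReal_re] using h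
  -- the Eisenstein weight and the descended Eisenstein series
  set W : GL (Fin n) (AdeleRing (𝓞 K) K) → ℝ≥0∞ := eisensteinWeight n K Φ σ with hW
  have hWm : Measurable W := measurable_eisensteinWeight
    (fun v => (hΦc.comp (continuous_const.matrix_vecMul Units.continuous_val)).measurable) σ
  have hWK : ∀ (γ : GL (Fin n) K) (g : GL (Fin n) (AdeleRing (𝓞 K) K)),
      W (Matrix.GeneralLinearGroup.map (algebraMap K (AdeleRing (𝓞 K) K)) γ * g) = W g :=
    fun γ g => eisensteinWeight_map_mul Φ σ γ g
  set E : (AdelicGroupData.gl n K).automorphicQuotient → ℂ :=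
    mirabolicEisensteinQuot νI (fun x => (Φ x : ℂ)) (σ : ℂ) with hE
  have hσ' : 1 < ((σ : ℂ)).re := by rwa [Complex.ofReal_re]
  have hEc : Continuous E := continuous_mirabolicEisensteinQuot_of_mem_piSchwartzBruhat K νI hΦS hσ'
  set EX : (AdelicGroupData.gl n K).automorphicQuotient → ℝ≥0∞ := fun x => ENNReal.ofReal (E x).re with hEX
  have hEXm : Measurable EX := ENNReal.measurable_ofReal.comp (Complex.continuous_re.comp hEc).measurable
  have hEg : ∀ g : GL (Fin n) (AdeleRing (𝓞 K) K),
      (∫⁻ a in 𝓕, W (Matrix.GeneralLinearGroup.scalar (Fin n) a * g⁻¹) ∂νI) < ⊤ ∧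
      E ((AdelicGroupData.gl n K).toAutomorphicQuotient g) =
        ((∫⁻ a in 𝓕, W (Matrix.GeneralLinearGroup.scalar (Fin n) a * g⁻¹) ∂νI).toReal : ℂ) := by
    intro g
    rw [hE, mirabolicEisensteinQuot_toAutomorphicQuotient]
    exact mirabolicEisenstein_ofReal_eq_toReal_setLIntegral_eisensteinWeight νI h𝓕 hΦS hΦ0 hσ g⁻¹
  have hEXg : ∀ g : GL (Fin n) (AdeleRing (𝓞 K) K), EX ((AdelicGroupData.gl n K).toAutomorphicQuotient g) =
      ∫⁻ a in 𝓕, W (Matrix.GeneralLinearGroup.scalar (Fin n) a * g⁻¹) ∂νI := by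
    intro g
    rw [hEX]
    simp only []
    rw [(hEg g).2, Complex.ofReal_re, ENNReal.ofReal_toReal (hEg g).1.ne]
  have hEXg' : ∀ g : GL (Fin n) (AdeleRing (𝓞 K) K), EX ((AdelicGroupData.gl n K).toAutomorphicQuotient g⁻¹) =
      ∫⁻ a in 𝓕, W (Matrix.GeneralLinearGroup.scalar (Fin n) a * g) ∂νI := by
    intro g
    have h := hEXg g⁻¹
    rw [inv_inv] at h
    exact h
  -- `F = |φ̃|²` and its central invariance
  set F : (AdelicGroupData.gl n K).automorphicQuotient → ℝ≥0∞ := fun x => ENNReal.ofReal (‖φt x‖ ^ 2) with hF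
  have hFm : Measurable F := ENNReal.measurable_ofReal.comp (hφtc.norm.pow 2).measurable
  obtain ⟨ω, -, -, -, -, hnorm, -⟩ := P.exists_centralCharacter_smoothedForm
  have hFZ : ∀ (z : ideleGroup K) (g : GL (Fin n) (AdeleRing (𝓞 K) K)),
      F ((AdelicGroupData.gl n K).toAutomorphicQuotient (Matrix.GeneralLinearGroup.scalar (Fin n) z * g)) =
        F ((AdelicGroupData.gl n K).toAutomorphicQuotient g) := by
    intro z g
    simp only [hF, hφt, hnorm η f z g]
  -- the two unfoldings: `∫_X E_X F dμ' = C₁ C₃ Ψ(σ)`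
  have h5' := h5 h𝓕 hWm hWK hFm hFZ hEXm hEXg hβG.1 hβG.2
  have h3' := h3 hφc hφK hcusp hΦ0 hΦm σ hβG.1 hβG.2
  have hG : (∫⁻ g : (AdelicGroupData.gl n K).Adelic,
      W g * βG g * F ((AdelicGroupData.gl n K).toAutomorphicQuotient g⁻¹)
        ∂(ν : Measure (AdelicGroupData.gl n K).Adelic)) =
      C₃ * rankinSelbergTorusIntegral n K νA νK
        (whittakerCoeff ν₀ (unipotentTateDomain n K) (adeleAddChar K) φ) Φ σ := by
    rw [h3']
    show (∫⁻ x : GL (Fin n) (AdeleRing (𝓞 K) K),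
      W x * βG x * F ((AdelicGroupData.gl n K).toAutomorphicQuotient x⁻¹) ∂ν) = _
    refine lintegral_congr fun g => ?_
    simp only [hF, hW, hφ, invQuot_apply]
    ring
  have hXeq : ∫⁻ x, EX x * F x ∂μ' = C₁ * (C₃ * rankinSelbergTorusIntegral n K νA νK
      (whittakerCoeff ν₀ (unipotentTateDomain n K) (adeleAddChar K) φ) Φ σ) :=
    h5'.trans (congrArg (fun t => C₁ * t) hG)
  -- Siegel domination of the automorphic measure
  obtain ⟨c, Ω, t, Z, hc, ht, hΩc, hΩB, hZc, hZ, hle⟩ := exists_lintegral_le_mul_setLIntegral_siegel n K μ' ν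
  set S : Set (GL (Fin n) (AdeleRing (𝓞 K) K)) := Z * (Ω * siegelCone n K t *
    (standardMaximalCompactGL n K : Set (GL (Fin n) (AdeleRing (𝓞 K) K)))) with hS
  obtain ⟨D, hD0, hD⟩ := exists_ideleNorm_det_le_of_mem_mul_siegelSet (n := n) (K := K) hΩc hZc t
  -- the majorant on the Siegel set
  set M : GL (Fin n) (AdeleRing (𝓞 K) K) → ℝ≥0∞ := fun g =>
    ∑' p : Projectivization K (Fin n → K),
      ∫⁻ a, (‖((Φ ((a : AdeleRing (𝓞 K) K) •
          (ratVec K p.rep ᵥ* (g : Matrix (Fin n) (Fin n) (AdeleRing (𝓞 K) K)))) : ℝ) : ℂ)‖ₑ : ℝ≥0∞) *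
        ENNReal.ofReal ((IdeleClassGroup.ideleNorm K a : ℝ) ^ ((n : ℝ) * σ)) ∂νI with hM
  have hmaj : ∫⁻ g in S, (‖φ g‖ₑ : ℝ≥0∞) ^ 2 * M g ∂ν < ⊤ :=
    setLIntegral_siegel_normSq_mul_majorant_lt_top_of_mem_piSchwartzBruhat (K := K) ν νI hΦS hσ hφc hφd hΩc
      hΩB ht hZc hZ
  -- pointwise on the Siegel set: `E_X(π g⁻¹) F(π g⁻¹) ≤ D^σ · |φ(g)|² M(g)`
  have hσ0 : 0 ≤ σ := (zero_le_one.trans hσ.le)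
  have hpt : ∀ g ∈ S, EX ((AdelicGroupData.gl n K).toAutomorphicQuotient g⁻¹) *
      F ((AdelicGroupData.gl n K).toAutomorphicQuotient g⁻¹) ≤
        ENNReal.ofReal (D ^ σ) * ((‖φ g‖ₑ : ℝ≥0∞) ^ 2 * M g) := by
    intro g hg
    rw [hEXg' g, setLIntegral_eisensteinWeight_scalar_mul_eq_tsum_mul νI h𝓕 hΦc hΦ0 σ g]
    have hdet : ENNReal.ofReal ((IdeleClassGroup.ideleNorm K (Matrix.GeneralLinearGroup.det g) : ℝ) ^ σ) ≤
        ENNReal.ofReal (D ^ σ) :=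
      ENNReal.ofReal_le_ofReal (Real.rpow_le_rpow (NNReal.coe_nonneg _) (hD g hg) hσ0)
    have hFφ : F ((AdelicGroupData.gl n K).toAutomorphicQuotient g⁻¹) = (‖φ g‖ₑ : ℝ≥0∞) ^ 2 := by
      simp only [hF, hφ, invQuot_apply]
      rw [← ofReal_norm, ← ENNReal.ofReal_pow (norm_nonneg _)]
    rw [hFφ]
    calc M g * ENNReal.ofReal ((IdeleClassGroup.ideleNorm K (Matrix.GeneralLinearGroup.det g) : ℝ) ^ σ) *
          (‖φ g‖ₑ : ℝ≥0∞) ^ 2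
        ≤ M g * ENNReal.ofReal (D ^ σ) * (‖φ g‖ₑ : ℝ≥0∞) ^ 2 := by gcongr
      _ = ENNReal.ofReal (D ^ σ) * ((‖φ g‖ₑ : ℝ≥0∞) ^ 2 * M g) := by ring
  -- assemble
  have hSm : MeasurableSet S := measurableSet_mul_siegelSet n K hZc hΩc ht
  have hXle : ∫⁻ x, EX x * F x ∂μ' ≤ c * (ENNReal.ofReal (D ^ σ) * ∫⁻ g in S, (‖φ g‖ₑ : ℝ≥0∞) ^ 2 * M g ∂ν) := by
    refine (hle fun x => EX x * F x).trans ?_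
    refine mul_le_mul_right ?_ c
    rw [← lintegral_const_mul' _ _ ENNReal.ofReal_ne_top]
    exact setLIntegral_mono' hSm fun g hg => hpt g hg
  have hXlt : ∫⁻ x, EX x * F x ∂μ' < ⊤ :=
    lt_of_le_of_lt hXle (ENNReal.mul_lt_top hc.lt_top (ENNReal.mul_lt_top ENNReal.ofReal_lt_top hmaj))
  rw [hXeq] at hXlt
  intro htop
  rw [htop, ENNReal.mul_top hC₃0, ENNReal.mul_top hC₁0] at hXlt
  exact lt_irrefl _ hXlt

end Finiteness

end Literature.NumberTheory.Automorphic
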